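import Mathlib
import Literature.Analysis.OperatorTheory.ContractiveDeterminantalRepresentation
import Literature.Analysis.OperatorTheory.ContractiveDeterminantalRepresentationProofs
import Literature.Analysis.OperatorTheory.TransferFunctionSchurBound
import Literature.Computability.AlgebraicComplexity.StandardFamilies
import Literature.Computability.AlgebraicComplexity.PermanentIrreducible

/-!
# Stub `stub_realizationHardness_nonSurjective` of crux `ContractivityPrice.ContractiveHardness`
# (line `registered` = BC3 birth skeleton `Cruxes/ContractiveHardness/Lines/birth.lean`, reshaped)

The realization-hardness half of the line asks that the rational function
`z^m Q̄_n(1/z) / Q_n(z)` (`m = blockOrder κ`, `Q_n = per_n(I + z/(4n))` the stabilised permanent)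
have no UNITARY transfer-function realization of quasi-polynomial order.  This file settles — with
NO size restriction at all — the case where the block structure `κ : Fin R → [n]²` of the
contractive realization MISSES A VARIABLE `e` (`κ` not surjective, e.g. every `κ` with `R < n²`):
then `m e = 0`, the "reflection" `conjReverse m Q_n` is not the true reflection, and the quotient
is not even a Schur function, so no unitary `U` of any size realizes it.

Proof.  A unitary realization forces `|num(z)| ≤ |den(z)|` on the closed unit polydisc
(`IsRealizedBy.norm_eval_le`, Literature `TransferFunctionSchurBound`).  Test it at the point
`z⋆ = 𝟙[e ↦ 0]`: since `m e = 0`, every monomial `z^{(m − α)₊}` of `conjReverse m Q_n` is `1` at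
`z⋆`, so `num(z⋆) = conj (Σ_α a_α) = conj Q_n(𝟙)`; while `den(z⋆) = Q_n(𝟙[e ↦ 0]) = Σ_{α ∌ e} a_α`.
All coefficients `a_α` of `Q_n` are NONNEGATIVE reals (`Q_n` is the image of a polynomial over
`ℝ≥0`) and the variable `e` does OCCUR in `Q_n` (the substitution `x_e ↦ δ_e + z_e/(4n)` is
invertible and every variable occurs in `per_n`), so `den(z⋆) < num(z⋆)` — contradiction.

Contents: `map_stabPerNN` (the route's inline `Q_n` is the image in `ℂ[z]` of the same
substitution applied to `per_n` over `ℝ≥0`); `mem_vars_stabPer` (every variable occurs);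
`eval_update_lt_eval_one` (dropping an occurring variable strictly lowers the value at `𝟙` over
`ℝ≥0`); `eval_conjReverse_update_of_apply_eq_zero`; the general obstruction
`not_isRealizedBy_conjReverse_map_of_apply_eq_zero`; and the registered stub
`stub_realizationHardness_nonSurjective`.
-/

noncomputable section

namespace Summit.ValiantsHypothesis.ValiantsHypothesis.Theorems

open MvPolynomial Matrix Literature.Analysis.OperatorTheory
open scoped NNReal

set_option linter.dupNamespace false

/-! ## A general obstruction: a missing variable breaks the Schur bound -/

section General

variable {τ : Type*}

/-- The embedding `ℝ≥0 → ℂ` (`algebraMap`) is `r ↦ ((r : ℝ) : ℂ)`. [folklore] -/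
theorem algebraMap_nnreal_complex_apply (r : ℝ≥0) : algebraMap ℝ≥0 ℂ r = ((r : ℝ) : ℂ) := rfl

/-- `‖(r : ℂ)‖ = r` for `r ≥ 0`. [folklore] -/
theorem norm_algebraMap_nnreal_complex (r : ℝ≥0) : ‖algebraMap ℝ≥0 ℂ r‖ = r := by
  rw [algebraMap_nnreal_complex_apply, Complex.norm_real, Real.norm_eq_abs, abs_of_nonneg r.coe_nonneg]

/-- At a point all of whose coordinates other than `e` equal `1`, the truncated reflection
`conjReverse m p` with `m e = 0` evaluates to `conj (p(𝟙))`: every monomial `z^{(m − α)₊}` has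
exponent `0` at `e` and base `1` elsewhere. [folklore] -/
theorem eval_conjReverse_update_of_apply_eq_zero [DecidableEq τ] (m : τ →₀ ℕ)
    (p : MvPolynomial τ ℂ) {e : τ} (he : m e = 0) (a : ℂ) :
    MvPolynomial.eval (Function.update (fun _ => (1 : ℂ)) e a) (conjReverse m p) =
      starRingEnd ℂ (MvPolynomial.eval (fun _ => (1 : ℂ)) p) := by
  unfold conjReverse
  rw [map_sum, MvPolynomial.eval_eq, map_sum]
  refine Finset.sum_congr rfl fun α _ => ?_
  rw [MvPolynomial.eval_monomial]
  have hprod : ((m - α).prod fun i k => Function.update (fun _ => (1 : ℂ)) e a i ^ k) = 1 := by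
    refine Finset.prod_eq_one fun i hi => ?_
    have hie : i ≠ e := by
      rintro rfl
      rw [Finsupp.mem_support_iff, Finsupp.tsub_apply, he, Nat.zero_sub] at hi
      exact hi rfl
    show Function.update (fun _ => (1 : ℂ)) e a i ^ ((m - α) i) = 1
    rw [Function.update_of_ne hie, one_pow]
  have hone : (∏ i ∈ α.support, (fun _ => (1 : ℂ)) i ^ α i) = 1 :=
    Finset.prod_eq_one fun i _ => one_pow _
  rw [hprod, mul_one, hone, mul_one]

/-- Over `ℝ≥0`: setting an OCCURRING variable `e` to `0` strictly lowers the value at the all-ones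
point (no cancellation). [folklore] -/
theorem eval_update_lt_eval_one [DecidableEq τ] (q : MvPolynomial τ ℝ≥0) {e : τ} (he : e ∈ q.vars) :
    MvPolynomial.eval (Function.update (fun _ => (1 : ℝ≥0)) e 0) q <
      MvPolynomial.eval (fun _ => (1 : ℝ≥0)) q := by
  rw [MvPolynomial.eval_eq, MvPolynomial.eval_eq]
  -- at `𝟙` every monomial is `1`; at `𝟙[e ↦ 0]` the monomials containing `e` vanish
  have h1 : ∀ d ∈ q.support, coeff d q * ∏ i ∈ d.support, (fun _ => (1 : ℝ≥0)) i ^ d i = coeff d q := by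
    intro d _
    rw [Finset.prod_eq_one fun i _ => one_pow _, mul_one]
  have h0 : ∀ d ∈ q.support,
      coeff d q * ∏ i ∈ d.support, Function.update (fun _ => (1 : ℝ≥0)) e 0 i ^ d i =
        if e ∈ d.support then 0 else coeff d q := by
    intro d _
    split_ifs with hed
    · rw [Finset.prod_eq_zero hed, mul_zero]
      rw [Function.update_self, zero_pow (Finsupp.mem_support_iff.mp hed)]
    · rw [Finset.prod_eq_one, mul_one]
      intro i hi
      have hie : i ≠ e := fun h => hed (h ▸ hi)
      rw [Function.update_of_ne hie, one_pow]
  rw [Finset.sum_congr rfl h0, Finset.sum_congr rfl h1, Finset.sum_ite, Finset.sum_const_zero,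
    zero_add]
  rw [← Finset.sum_filter_add_sum_filter_not q.support (fun d => e ∈ d.support) (fun d => coeff d q)]
  -- the dropped part is positive: `e` occurs in some monomial
  obtain ⟨d, hd, hed⟩ := (MvPolynomial.mem_vars_iff_mem_support e).mp he
  have hpos : 0 < ∑ d ∈ q.support.filter (fun d => e ∈ d.support), coeff d q := by
    refine lt_of_lt_of_le ?_ (Finset.single_le_sum (f := fun d => coeff d q) (fun d _ => zero_le)
      (Finset.mem_filter.mpr ⟨hd, hed⟩))
    exact pos_iff_ne_zero.mpr (MvPolynomial.mem_support_iff.mp hd)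
  exact lt_add_of_pos_left _ hpos

/-- Evaluating the image of an `ℝ≥0`-polynomial at the image of an `ℝ≥0`-point. [folklore] -/
theorem eval_map_algebraMap_nnreal (q : MvPolynomial τ ℝ≥0) (g : τ → ℝ≥0) :
    MvPolynomial.eval (fun i => (algebraMap ℝ≥0 ℂ) (g i)) (MvPolynomial.map (algebraMap ℝ≥0 ℂ) q) =
      (algebraMap ℝ≥0 ℂ) (MvPolynomial.eval g q) := by
  rw [MvPolynomial.eval_map]
  change _ = (algebraMap ℝ≥0 ℂ) (MvPolynomial.eval₂ (RingHom.id _) g q)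
  rw [MvPolynomial.eval₂_comp_left, RingHom.comp_id]
  rfl

/-- **General obstruction.** Let `q` be a polynomial with nonnegative real coefficients in which
the variable `e` occurs, and `m` an order with `m e = 0`.  Then NO unitary colligation of any size
realizes `conjReverse m q / q` (viewed over `ℂ`): the Schur bound of
`IsRealizedBy.norm_eval_le` fails at `z⋆ = 𝟙[e ↦ 0]`, where the numerator is `conj q(𝟙)` and the
denominator is `q(𝟙[e ↦ 0]) < q(𝟙)`. [folklore] -/
theorem not_isRealizedBy_conjReverse_map_of_apply_eq_zero [Fintype τ] [DecidableEq τ]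
    (q : MvPolynomial τ ℝ≥0) {e : τ} (he : e ∈ q.vars) {m : τ →₀ ℕ} (hm : m e = 0) {R' : ℕ}
    (κ' : Fin R' → τ) {U : Matrix (Fin 1 ⊕ Fin R') (Fin 1 ⊕ Fin R') ℂ}
    (hU : U ∈ Matrix.unitaryGroup (Fin 1 ⊕ Fin R') ℂ) :
    ¬ IsRealizedBy κ' U (conjReverse m (MvPolynomial.map (algebraMap ℝ≥0 ℂ) q))
        (MvPolynomial.map (algebraMap ℝ≥0 ℂ) q) := by
  intro h
  set p := MvPolynomial.map (algebraMap ℝ≥0 ℂ) q with hp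
  have hz : ∀ j, ‖Function.update (fun _ => (1 : ℂ)) e 0 j‖ ≤ 1 := by
    intro j
    rcases eq_or_ne j e with rfl | hje
    · simp
    · rw [Function.update_of_ne hje]; simp
  have hle := h.norm_eval_le hU hz
  -- numerator at `z⋆`
  have hnum : ‖MvPolynomial.eval (Function.update (fun _ => (1 : ℂ)) e 0) (conjReverse m p)‖ =
      MvPolynomial.eval (fun _ => (1 : ℝ≥0)) q := by
    rw [eval_conjReverse_update_of_apply_eq_zero m p hm, Complex.norm_conj]
    have : (fun _ : τ => (1 : ℂ)) = fun i => (algebraMap ℝ≥0 ℂ) ((fun _ => (1 : ℝ≥0)) i) := by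
      funext i; simp
    rw [this, hp, eval_map_algebraMap_nnreal, norm_algebraMap_nnreal_complex]
  -- denominator at `z⋆`
  have hden : ‖MvPolynomial.eval (Function.update (fun _ => (1 : ℂ)) e 0) p‖ =
      MvPolynomial.eval (Function.update (fun _ => (1 : ℝ≥0)) e 0) q := by
    have : Function.update (fun _ : τ => (1 : ℂ)) e 0 =
        fun i => (algebraMap ℝ≥0 ℂ) (Function.update (fun _ => (1 : ℝ≥0)) e 0 i) := by
      funext i
      rcases eq_or_ne i e with rfl | hie
      · simp
      · rw [Function.update_of_ne hie, Function.update_of_ne hie]; simp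
    rw [this, hp, eval_map_algebraMap_nnreal, norm_algebraMap_nnreal_complex]
  rw [hnum, hden, NNReal.coe_le_coe] at hle
  exact absurd (eval_update_lt_eval_one q he) (not_lt.mpr hle)

end General

/-! ## The stabilised permanent over `ℝ≥0` and its variables -/

section StabPer

open Literature.Computability.AlgebraicComplexity

/-- `Q_n = per_n(I + z/(4n))` has its NONNEGATIVE coefficients made structural: it is the image in
`ℂ[z]` of the same substitution applied to the generic permanent over `ℝ≥0`. [folklore] -/
theorem map_stabPerNN (n : ℕ) :
    MvPolynomial.map (algebraMap ℝ≥0 ℂ) (MvPolynomial.aeval (fun e : Fin n × Fin n =>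
        (MvPolynomial.C (if e.1 = e.2 then (1 : ℝ≥0) else 0) +
          MvPolynomial.C ((4 * (n : ℝ≥0))⁻¹) * MvPolynomial.X e : MvPolynomial (Fin n × Fin n) ℝ≥0))
      (perPoly (Fin n) ℝ≥0)) =
      MvPolynomial.aeval (fun e : Fin n × Fin n =>
          MvPolynomial.C (if e.1 = e.2 then (1 : ℂ) else 0) +
            MvPolynomial.C ((4 * (n : ℂ))⁻¹) * MvPolynomial.X e)
        (perPoly (Fin n) ℂ) := by
  have h4 : (algebraMap ℝ≥0 ℂ) ((4 * (n : ℝ≥0))⁻¹) = (4 * (n : ℂ))⁻¹ := by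
    rw [map_inv₀, map_mul, map_natCast, map_ofNat]
  have hδ : ∀ e : Fin n × Fin n,
      (algebraMap ℝ≥0 ℂ) (if e.1 = e.2 then (1 : ℝ≥0) else 0) = if e.1 = e.2 then (1 : ℂ) else 0 := by
    intro e
    split_ifs <;> simp
  rw [MvPolynomial.aeval_def, MvPolynomial.algebraMap_eq, MvPolynomial.eval₂_comp_left,
    MvPolynomial.aeval_def, ← map_perPoly ((algebraMap ℝ≥0 ℂ)), MvPolynomial.eval₂_map,
    MvPolynomial.algebraMap_eq]
  congr 1
  · ext r : 1
    simp
  · funext e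
    simp only [Function.comp_apply, map_add, map_mul, MvPolynomial.map_C, MvPolynomial.map_X, h4, hδ]

/-- **Every variable occurs in `Q_n`.** The substitution `x_e ↦ δ_e + x_e/(4n)` is invertible
(`x_e ↦ 4n (x_e − δ_e)` undoes it), and every variable occurs in `per_n`
(`degreeOf_perPoly = 1`). [folklore] -/
theorem mem_vars_stabPer {n : ℕ} (e : Fin n × Fin n) :
    e ∈ (MvPolynomial.aeval (fun e : Fin n × Fin n =>
          MvPolynomial.C (if e.1 = e.2 then (1 : ℂ) else 0) +
            MvPolynomial.C ((4 * (n : ℂ))⁻¹) * MvPolynomial.X e)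
        (perPoly (Fin n) ℂ)).vars := by
  have hn : (4 * (n : ℂ)) ≠ 0 := by
    have : n ≠ 0 := by
      rintro rfl
      exact (IsEmpty.false e.1 : False)
    exact mul_ne_zero (by norm_num) (Nat.cast_ne_zero.mpr this)
  set c : ℂ := 4 * (n : ℂ) with hc4
  set φ : Fin n × Fin n → MvPolynomial (Fin n × Fin n) ℂ := fun e =>
    MvPolynomial.C (if e.1 = e.2 then (1 : ℂ) else 0) + MvPolynomial.C c⁻¹ * MvPolynomial.X e
    with hφ
  set ψ : Fin n × Fin n → MvPolynomial (Fin n × Fin n) ℂ := fun e =>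
    MvPolynomial.C c * (MvPolynomial.X e - MvPolynomial.C (if e.1 = e.2 then (1 : ℂ) else 0))
    with hψ
  set Q := MvPolynomial.aeval φ (perPoly (Fin n) ℂ) with hQ
  -- `ψ` undoes `φ`
  have hinv : MvPolynomial.aeval ψ Q = perPoly (Fin n) ℂ := by
    rw [hQ, ← AlgHom.comp_apply, MvPolynomial.comp_aeval]
    have hid : (fun i => MvPolynomial.aeval ψ (φ i)) = MvPolynomial.X := by
      funext i
      have h1 : MvPolynomial.aeval ψ (φ i) =
          MvPolynomial.C (if i.1 = i.2 then (1 : ℂ) else 0) +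
            MvPolynomial.C c⁻¹ * (MvPolynomial.C c *
              (MvPolynomial.X i - MvPolynomial.C (if i.1 = i.2 then (1 : ℂ) else 0))) := by
        simp only [hφ, hψ, map_add, map_mul, MvPolynomial.aeval_C, MvPolynomial.aeval_X,
          MvPolynomial.algebraMap_eq]
      rw [h1, ← mul_assoc, ← map_mul, inv_mul_cancel₀ hn, map_one, one_mul]
      ring
    rw [hid, MvPolynomial.aeval_X_left, AlgHom.id_apply]
  -- `e` occurs in `per_n`
  have hper : e ∈ (perPoly (Fin n) ℂ).vars := by
    have hdeg : 0 < MvPolynomial.degreeOf e (perPoly (Fin n) ℂ) := by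
      rw [degreeOf_perPoly]; exact one_pos
    rw [MvPolynomial.degreeOf_eq_sup, Finset.lt_sup_iff] at hdeg
    obtain ⟨d, hd, hde⟩ := hdeg
    exact (MvPolynomial.mem_vars_iff_mem_support e).mpr ⟨d, hd, Finsupp.mem_support_iff.mpr (Nat.pos_iff_ne_zero.mp hde)⟩
  -- variables of `aeval ψ Q` come from variables of `Q`
  rw [← hinv, MvPolynomial.aeval_eq_bind₁] at hper
  obtain ⟨i, hi, hei⟩ := Finset.mem_biUnion.mp (MvPolynomial.vars_bind₁ ψ Q hper)
  have hsub : (ψ i).vars ⊆ {i} := by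
    intro x hx
    simp only [hψ] at hx
    have hx1 := MvPolynomial.vars_mul _ _ hx
    rw [MvPolynomial.vars_C, Finset.empty_union] at hx1
    have hx2 := MvPolynomial.vars_sub_subset _ hx1
    rwa [MvPolynomial.vars_X, MvPolynomial.vars_C, Finset.union_empty] at hx2
  have : e = i := Finset.mem_singleton.mp (hsub hei)
  rw [this]
  exact hi

/-- Hence every variable occurs in the `ℝ≥0` version of `Q_n` as well. [folklore] -/
theorem mem_vars_stabPerNN {n : ℕ} (e : Fin n × Fin n) :
    e ∈ (MvPolynomial.aeval (fun e : Fin n × Fin n =>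
        (MvPolynomial.C (if e.1 = e.2 then (1 : ℝ≥0) else 0) +
          MvPolynomial.C ((4 * (n : ℝ≥0))⁻¹) * MvPolynomial.X e : MvPolynomial (Fin n × Fin n) ℝ≥0))
      (perPoly (Fin n) ℝ≥0)).vars :=
  by
  have h := mem_vars_stabPer (n := n) e
  rw [← map_stabPerNN n] at h
  exact MvPolynomial.vars_map (p := _) (f := _) h

/-- A non-surjective block structure has a zero in its block order. [folklore] -/
theorem exists_blockOrder_eq_zero_of_not_surjective {σ : Type*} [DecidableEq σ] {R : ℕ}
    {κ : Fin R → σ} (hκ : ¬ Function.Surjective κ) : ∃ e, blockOrder κ e = 0 := by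
  obtain ⟨e, he⟩ := not_forall.mp hκ
  refine ⟨e, ?_⟩
  rw [blockOrder, Finsupp.coe_finsetSum, Finset.sum_apply]
  refine Finset.sum_eq_zero fun i _ => ?_
  rw [Finsupp.single_apply, if_neg]
  exact fun h => he ⟨i, h⟩

end StabPer

/-! ## The registered stub -/

/-- **Registered stub `stub_realizationHardness_nonSurjective`** (line `registered`/birth of crux
`ContractivityPrice.ContractiveHardness`, reshaped skeleton): if the block structure `κ` of a
contractive realization of the stabilised permanent `Q_n = per_n(I + z/(4n))` misses some
variable, then `z^{blockOrder κ} Q̄_n(1/z) / Q_n` — with the tree's truncated `conjReverse` — has NO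
unitary transfer-function realization of ANY order: at `z⋆ = 𝟙[e ↦ 0]` (`e` a missed variable) the
numerator has modulus `Q_n(𝟙)` and the denominator the strictly smaller value `Q_n(𝟙[e ↦ 0])`,
violating the Schur bound forced by a unitary colligation. [folklore] -/
theorem stub_realizationHardness_nonSurjective :
    ∀ (n R : ℕ) (κ : Fin R → Fin n × Fin n), ¬ Function.Surjective κ →
      ∀ (R' : ℕ) (κ' : Fin R' → Fin n × Fin n)
        (U : Matrix (Fin 1 ⊕ Fin R') (Fin 1 ⊕ Fin R') ℂ),
        U ∈ Matrix.unitaryGroup (Fin 1 ⊕ Fin R') ℂ →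
        ¬ IsRealizedBy κ' U
            (conjReverse (blockOrder κ)
              (MvPolynomial.aeval (fun e : Fin n × Fin n =>
                  MvPolynomial.C (if e.1 = e.2 then (1 : ℂ) else 0) +
                    MvPolynomial.C ((4 * (n : ℂ))⁻¹) * MvPolynomial.X e)
                (Literature.Computability.AlgebraicComplexity.perPoly (Fin n) ℂ)))
            (MvPolynomial.aeval (fun e : Fin n × Fin n =>
                MvPolynomial.C (if e.1 = e.2 then (1 : ℂ) else 0) +
                  MvPolynomial.C ((4 * (n : ℂ))⁻¹) * MvPolynomial.X e)
              (Literature.Computability.AlgebraicComplexity.perPoly (Fin n) ℂ)) := by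
  intro n R κ hκ R' κ' U hU
  obtain ⟨e, he⟩ := exists_blockOrder_eq_zero_of_not_surjective hκ
  rw [← map_stabPerNN n]
  exact not_isRealizedBy_conjReverse_map_of_apply_eq_zero _ (mem_vars_stabPerNN e) he κ' hU

end Summit.ValiantsHypothesis.ValiantsHypothesis.Theorems

end
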